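import Summits.AtomisticToContinuum.Crystallization.Theorems.FrustratedLawDichotomyThinning
import Summits.AtomisticToContinuum.Crystallization.Theorems.FrustratedLawDichotomyVirial
import Summits.AtomisticToContinuum.Crystallization.Theorems.ContactSaturationLadderWindowFilling

/-!
# FrustratedLawDichotomy · crux `AperiodicFrustratedLawGap` (stmt-AtomisticToContinuum-27623) — DELETED ATOMS: bookkeeping and mass transport
# for the NO-RATTLERS theorem (decomp-a2c, prover hand 2, structural share, generation 2)

First application of THINNING STABILITY (`FrustratedLawDichotomyThinning.thinning_stability`): delete the `R`-ISOLATED atoms (those with no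
other atom within distance `R`), i.e. thin by `G_R = {ν | 1 < ν(B̄(0,R))}`.  At a kept root the deletion raises the root energy by at most
`(1/12) Σ_{y isolated} ‖y‖⁻⁶`; by MASS TRANSPORT (Mecke) `E_P[1_{G} Σ_{y isolated} ‖y‖⁻⁶] ≤ E_P[1_{Gᶜ} Σ_{y ≠ 0} ‖y‖⁻⁶]`, and at an isolated
root `Σ_{y≠0} ‖y‖⁻⁶ ≤ 250 δ⁻³ R⁻³` (two-scale shell bound) while `rootEnergy ≥ −(1/12) Σ ‖y‖⁻⁶`.  For a minimiser this gives
`P(Gᶜ)·|e⋆| ≤ P(Gᶜ)·(250/6) δ⁻³ R⁻³`, so with `e⋆ ≤ −1/24`: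

This file: the crowding event `G_R` and isolated atoms (`measurableSet_crowded`, `map_sub_mem_crowded_iff`, `lt_dist_of_isolated`), the
two-scale shell bound at an isolated root (`lintegral_invPow_six_le_two_scale`, from `ContactSaturationLadderWindowFilling.sum_inv_pow_six_le_two_scale_idx`),
the energy bookkeeping of a deletion (`rootEnergy_restrict_le`: a kept root loses at most `(1/12) Σ_{deleted} ‖y‖⁻⁶`; `neg_moment_le_rootEnergy`),
and the MASS-TRANSPORT inequality `lintegral_deleted_le` (for ANY measurable `G`).  The theorem itself is `FrustratedLawDichotomyNoRattlers`.
All `[folklore]`.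
-/

noncomputable section

namespace Summit.AtomisticToContinuum.Crystallization.Theorems.FrustratedLawDichotomyThinning

open MeasureTheory Metric Set Filter ProbabilityTheory
open scoped ENNReal Topology BigOperators
open Literature.MathematicalPhysics.StatisticalMechanics Literature.Probability.Process
open Literature.Probability.Process.LocalConfig (finite_inter_of_separated)
open Summit.AtomisticToContinuum.Crystallization.Theorems.ChargedEnergyGapNegative
  (E3 eStar eStar_le_groundStateEnergy_div dimer dimer_injective interactionEnergy_dimer)
open Summit.AtomisticToContinuum.Crystallization.Theorems.BenjaminiSchrammLimit (measurableSet_setOf_isRootedHardCore)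
open Summit.AtomisticToContinuum.Crystallization.Theorems.FrustratedLawDichotomyFiniteClusterGap
  (ae_mem_of_sep exists_kernel_eq_count_restrict measurable_kernel_map_sub integrable_rootEnergy_of_ae_hardCore)
open Summit.AtomisticToContinuum.Crystallization.Theorems.FrustratedLawDichotomyVirial
  (measurable_ofReal_invPow integrable_invPow rootEnergy_eq_moments lintegral_invPow_le_of_isRootedHardCore)
open Summit.AtomisticToContinuum.Crystallization.Theorems.ContactSaturationLadderWindowFilling (sum_inv_pow_six_le_two_scale_idx)

section DeletedAtoms

variable {δ R : ℝ} {P : Measure (Measure E3)}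

/-! ### The crowding event and the isolated atoms -/

/-- The event «another atom within distance `R` of the root» is Giry-measurable. [folklore] -/
theorem measurableSet_crowded (R : ℝ) : MeasurableSet {ν : Measure E3 | 1 < ν (closedBall (0 : E3) R)} :=
  measurableSet_lt measurable_const (Measure.measurable_coe measurableSet_closedBall)

/-- An atom `u` is kept by the `R`-crowding thinning iff `1 < μ(B̄(u,R))`. [folklore] -/
theorem map_sub_mem_crowded_iff (μ : Measure E3) (R : ℝ) (u : E3) :
    μ.map (fun x : E3 => x - u) ∈ {ν : Measure E3 | 1 < ν (closedBall (0 : E3) R)} ↔ 1 < μ (closedBall u R) := by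
  rw [Set.mem_setOf_eq, Measure.map_apply (measurable_sub_const u) measurableSet_closedBall]
  have : (fun x : E3 => x - u) ⁻¹' closedBall (0 : E3) R = closedBall u R := by
    ext x; simp [mem_closedBall, dist_eq_norm]
  rw [this]

/-- An `R`-isolated atom of `count|S` is at distance `> R` from every other atom. [folklore] -/
theorem lt_dist_of_isolated {S : Set E3} {u : E3} (hu : u ∈ S)
    (hiso : ¬ 1 < (Measure.count : Measure E3).restrict S (closedBall u R)) {v : E3} (hv : v ∈ S) (hvu : v ≠ u) :
    R < dist v u := by
  by_contra hle
  rw [not_lt] at hle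
  apply hiso
  rw [Measure.restrict_apply measurableSet_closedBall]
  have hsub : ({u} ∪ {v} : Set E3) ⊆ closedBall u R ∩ S := by
    rintro x (rfl | rfl)
    · exact ⟨mem_closedBall_self (dist_nonneg.trans hle), hu⟩
    · exact ⟨mem_closedBall.2 hle, hv⟩
  calc (1 : ℝ≥0∞) < 1 + 1 := by norm_num
    _ = Measure.count ({u} ∪ {v} : Set E3) := by
        rw [measure_union (Set.disjoint_singleton.2 hvu.symm) (measurableSet_singleton v), Measure.count_singleton,
          Measure.count_singleton]
    _ ≤ Measure.count (closedBall u R ∩ S) := measure_mono hsub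

/-- **Two-scale shell bound at an isolated root**: if all atoms `y ≠ 0` of a `δ`-separated `S ∋ 0` have `‖y‖ ≥ R ≥ δ`, then
`Σ_{y ∈ S} ‖y‖⁻⁶ ≤ 250 δ⁻³ R⁻³`. [folklore] -/
theorem lintegral_invPow_six_le_two_scale (hδ : 0 < δ) (hδR : δ ≤ R) {S : Set E3} (h0 : (0 : E3) ∈ S)
    (hsep : ∀ x ∈ S, ∀ y ∈ S, x ≠ y → δ ≤ dist x y) (hfar : ∀ y ∈ S, y ≠ 0 → R ≤ ‖y‖) :
    ∫⁻ y, ENNReal.ofReal (‖y‖⁻¹ ^ 6) ∂((Measure.count : Measure E3).restrict S) ≤ ENNReal.ofReal (250 * δ⁻¹ ^ 3 * R⁻¹ ^ 3) := by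
  classical
  have hS : S.Countable := by
    have : S = ⋃ n : ℕ, closedBall (0 : E3) n ∩ S := by
      ext x
      simp only [mem_iUnion, mem_inter_iff, mem_closedBall, dist_zero_right]
      exact ⟨fun hx => ⟨⌈‖x‖⌉₊, Nat.le_ceil _, hx⟩, fun ⟨n, _, hx⟩ => hx⟩
    rw [this]
    exact countable_iUnion fun n => (finite_inter_of_separated hδ hsep (isCompact_closedBall (0 : E3) n)).countable
  -- finite sums over `T ∋ 0`, `T ⊆ S`
  have hfin : ∀ T : Finset E3, (∀ z ∈ T, z ∈ S) → (0 : E3) ∈ T → ∑ z ∈ T.erase 0, ‖z‖⁻¹ ^ 6 ≤ 250 * δ⁻¹ ^ 3 * R⁻¹ ^ 3 := by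
    intro T hTS h0T
    set U : Finset E3 := T.erase 0 with hU
    set e := U.equivFin with he
    set y : Fin U.card → E3 := fun i => (e.symm i : E3) with hy
    have hyU : ∀ i, y i ∈ U := fun i => (e.symm i).2
    have h := sum_inv_pow_six_le_two_scale_idx y Finset.univ 0 hδ hδR
      (fun k _ l _ hkl => hsep _ (hTS _ (Finset.mem_of_mem_erase (hyU k))) _ (hTS _ (Finset.mem_of_mem_erase (hyU l)))
        fun hh => hkl (e.symm.injective (Subtype.ext hh)))
      (fun k _ => by
        rw [dist_comm, dist_zero_right]
        exact hfar _ (hTS _ (Finset.mem_of_mem_erase (hyU k))) (Finset.ne_of_mem_erase (hyU k)))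
    refine le_trans (le_of_eq ?_) h
    refine Finset.sum_bij' (fun z hz => e ⟨z, hz⟩) (fun k _ => (e.symm k : E3)) ?_ ?_ ?_ ?_ ?_
    · intro z hz; exact Finset.mem_univ _
    · intro k hk; exact (e.symm k).2
    · intro z hz; simp
    · intro k hk; simp
    · intro z hz; simp [hy, dist_zero_right, dist_comm]
  rw [lintegral_countable _ hS, ENNReal.tsum_eq_iSup_sum]
  refine iSup_le fun T' => ?_
  set T : Finset E3 := insert 0 (T'.map (Function.Embedding.subtype (· ∈ S))) with hTdef
  have hTS : ∀ z ∈ T, z ∈ S := by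
    intro z hz
    rcases Finset.mem_insert.1 hz with rfl | hz
    · exact h0
    · obtain ⟨w, -, rfl⟩ := Finset.mem_map.1 hz
      exact w.2
  have h0T : (0 : E3) ∈ T := Finset.mem_insert_self _ _
  calc ∑ z ∈ T', ENNReal.ofReal (‖(z : E3)‖⁻¹ ^ 6) * (Measure.count : Measure E3) {(z : E3)}
      = ∑ z ∈ T', ENNReal.ofReal (‖(z : E3)‖⁻¹ ^ 6) := Finset.sum_congr rfl fun z _ => by
        rw [Measure.count_singleton, mul_one]
    _ = ∑ z ∈ T'.map (Function.Embedding.subtype (· ∈ S)), ENNReal.ofReal (‖z‖⁻¹ ^ 6) := by rw [Finset.sum_map]; rfl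
    _ ≤ ∑ z ∈ T, ENNReal.ofReal (‖z‖⁻¹ ^ 6) := Finset.sum_le_sum_of_subset (Finset.subset_insert _ _)
    _ = ∑ z ∈ T.erase 0, ENNReal.ofReal (‖z‖⁻¹ ^ 6) := by
        rw [← Finset.add_sum_erase T _ h0T, norm_zero, inv_zero, zero_pow (by norm_num), ENNReal.ofReal_zero, zero_add]
    _ = ENNReal.ofReal (∑ z ∈ T.erase 0, ‖z‖⁻¹ ^ 6) := (ENNReal.ofReal_sum_of_nonneg fun z _ => by positivity).symm
    _ ≤ ENNReal.ofReal (250 * δ⁻¹ ^ 3 * R⁻¹ ^ 3) := ENNReal.ofReal_le_ofReal (hfin T hTS h0T)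

/-! ### Energy bookkeeping of the deletion -/

/-- The Lennard-Jones field of the root is integrable against a rooted hard-core configuration. [folklore] -/
theorem integrable_lennardJones_norm (hδ : 0 < δ) {μ : Measure E3} (hμ : IsRootedHardCore δ μ) :
    Integrable (fun y : E3 => lennardJones ‖y‖) μ := by
  obtain ⟨h6, h12⟩ := integrable_invPow hδ hμ
  have hfun : (fun y : E3 => lennardJones ‖y‖) = fun y : E3 => 1 / 12 * ‖y‖⁻¹ ^ 12 - 1 / 6 * ‖y‖⁻¹ ^ 6 := by
    funext y; unfold lennardJones; ring
  rw [hfun]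
  exact (h12.const_mul _).sub (h6.const_mul _)

/-- **Deletion raises a kept root's energy by at most `(1/12) Σ_{deleted} ‖y‖⁻⁶`**: for a rooted hard-core `μ` and a measurable set `K` of
kept atoms, `rootEnergy(μ|K) ≤ rootEnergy(μ) + (1/12) ∫_{Kᶜ} ‖y‖⁻⁶ dμ`. [folklore] -/
theorem rootEnergy_restrict_le (hδ : 0 < δ) {μ : Measure E3} (hμ : IsRootedHardCore δ μ) {K : Set E3} (hK : MeasurableSet K) :
    rootEnergy lennardJones (μ.restrict K) ≤
      rootEnergy lennardJones μ + 1 / 12 * (∫⁻ y in Kᶜ, ENNReal.ofReal (‖y‖⁻¹ ^ 6) ∂μ).toReal := by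
  have hint := integrable_lennardJones_norm hδ hμ
  obtain ⟨h6, -⟩ := integrable_invPow hδ hμ
  rw [rootEnergy_def, rootEnergy_def, ← integral_add_compl hK hint]
  -- the deleted part: `-∫_{Kᶜ} V ≤ (1/6) ∫_{Kᶜ} ‖y‖⁻⁶`
  have hle : -(∫ y in Kᶜ, lennardJones ‖y‖ ∂μ) ≤ 1 / 6 * ∫ y in Kᶜ, ‖y‖⁻¹ ^ 6 ∂μ := by
    rw [← integral_neg, ← integral_const_mul]
    exact integral_mono_ae hint.neg.integrableOn (h6.const_mul _).integrableOn
      (Eventually.of_forall fun y => by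
        -- `V_LJ(r) ≥ -(1/6) r⁻⁶` (= `PhononSlackCertificatesAllBadGapFloor.neg_inv_pow_six_le_lennardJones`, inlined: that module is
        -- outside this file's import cone)
        have h0 : 0 ≤ 1 / 12 * ‖y‖⁻¹ ^ 12 := by positivity
        show -lennardJones ‖y‖ ≤ 1 / 6 * ‖y‖⁻¹ ^ 6
        unfold lennardJones
        linarith)
  have heq : ∫ y in Kᶜ, ‖y‖⁻¹ ^ 6 ∂μ = (∫⁻ y in Kᶜ, ENNReal.ofReal (‖y‖⁻¹ ^ 6) ∂μ).toReal :=
    integral_eq_lintegral_of_nonneg_ae (Eventually.of_forall fun y => by positivity) h6.integrableOn.aestronglyMeasurable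
  rw [← heq]
  linarith

/-- At any root: `rootEnergy ≥ −(1/12) Σ ‖y‖⁻⁶`. [folklore] -/
theorem neg_moment_le_rootEnergy (hδ : 0 < δ) {μ : Measure E3} (hμ : IsRootedHardCore δ μ) :
    -(1 / 12 * (∫⁻ y, ENNReal.ofReal (‖y‖⁻¹ ^ 6) ∂μ).toReal) ≤ rootEnergy lennardJones μ := by
  rw [rootEnergy_eq_moments hδ hμ]
  have : 0 ≤ (∫⁻ y, ENNReal.ofReal (‖y‖⁻¹ ^ 12) ∂μ).toReal := ENNReal.toReal_nonneg
  linarith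

/-! ### Mass transport: what the kept roots lose to deleted atoms is what the deleted roots see -/

/-- **MASS TRANSPORT FOR THE DELETED ATOMS.**  For a point-stationary law almost surely carried by rooted `δ`-hard-core configurations and a
measurable `G` (kept atoms `u`: `θ_u μ ∈ G`): `E_P[1_G(μ) Σ_{y deleted} ‖y‖⁻⁶] ≤ E_P[1_{Gᶜ}(μ) Σ_y ‖y‖⁻⁶]` (Mecke for
`g(μ, y) = 1_G(μ) 1[y deleted] ‖y‖⁻⁶`: the involution swaps «root kept, `y` deleted» with «root deleted, `y` kept»). [folklore] -/
theorem lintegral_deleted_le (hδ : 0 < δ) (hcore : ∀ᵐ μ ∂P, IsRootedHardCore δ μ) (hstat : IsPointStationaryLaw P)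
    {G : Set (Measure E3)} (hG : MeasurableSet G) :
    ∫⁻ μ in G, (∫⁻ y in {u : E3 | μ.map (fun x : E3 => x - u) ∈ G}ᶜ, ENNReal.ofReal (‖y‖⁻¹ ^ 6) ∂μ) ∂P ≤
      ∫⁻ μ in Gᶜ, (∫⁻ y, ENNReal.ofReal (‖y‖⁻¹ ^ 6) ∂μ) ∂P := by
  classical
  obtain ⟨κ, hκs, hκ⟩ := exists_kernel_eq_count_restrict hδ
  have hκid : ∀ μ : Measure E3, IsRootedHardCore δ μ → κ μ = μ := by
    rintro μ ⟨S, -, hsep, rfl⟩; exact hκ S hsep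
  set A : Set (Measure E3 × E3) := (fun q : Measure E3 × E3 => (κ q.1).map fun z => z - q.2) ⁻¹' G with hAdef
  have hA : MeasurableSet A := measurable_kernel_map_sub κ hG
  have hsec : ∀ μ : Measure E3, IsRootedHardCore δ μ → ∀ y : E3,
      ((μ, y) ∈ A ↔ y ∈ {u : E3 | μ.map (fun x : E3 => x - u) ∈ G}) := fun μ hμ y => by
    simp only [hAdef, Set.mem_preimage, Set.mem_setOf_eq, hκid μ hμ]
  have hKm : ∀ μ : Measure E3, IsRootedHardCore δ μ → MeasurableSet {u : E3 | μ.map (fun x : E3 => x - u) ∈ G} := by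
    intro μ hμ
    have : {u : E3 | μ.map (fun x : E3 => x - u) ∈ G} = Prod.mk μ ⁻¹' A := by
      ext u; rw [Set.mem_preimage, hsec μ hμ u]
    rw [this]; exact measurable_prodMk_left hA
  set f : E3 → ℝ≥0∞ := fun y => ENNReal.ofReal (‖y‖⁻¹ ^ 6) with hf
  have hfm : Measurable f := measurable_ofReal_invPow 6
  set g : Measure E3 → E3 → ℝ≥0∞ := fun μ y =>
    G.indicator (fun _ => (1 : ℝ≥0∞)) μ * (Aᶜ.indicator (fun _ => (1 : ℝ≥0∞)) (μ, y) * f y) with hg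
  have hgm : Measurable (Function.uncurry g) :=
    ((measurable_const.indicator hG).comp measurable_fst).mul ((measurable_const.indicator hA.compl).mul (hfm.comp measurable_snd))
  have key := hstat g hgm
  -- left side: the quantity to bound
  have hL : ∫⁻ μ, ∫⁻ y, g μ y ∂μ ∂P =
      ∫⁻ μ in G, (∫⁻ y in {u : E3 | μ.map (fun x : E3 => x - u) ∈ G}ᶜ, f y ∂μ) ∂P := by
    rw [← lintegral_indicator hG]
    refine lintegral_congr_ae (hcore.mono fun μ hμ => ?_)
    dsimp only
    by_cases hμG : μ ∈ G
    · rw [Set.indicator_of_mem hμG, ← lintegral_indicator (hKm μ hμ).compl]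
      refine lintegral_congr fun y => ?_
      simp only [hg, Set.indicator_of_mem hμG, one_mul]
      by_cases hy : y ∈ {u : E3 | μ.map (fun x : E3 => x - u) ∈ G}
      · rw [Set.indicator_of_notMem (fun h => Set.notMem_of_mem_compl h ((hsec μ hμ y).2 hy)),
          Set.indicator_of_notMem (fun h => Set.notMem_of_mem_compl h hy), zero_mul]
      · rw [Set.indicator_of_mem (show (μ, y) ∈ Aᶜ from fun h => hy ((hsec μ hμ y).1 h)),
          Set.indicator_of_mem (show y ∈ {u : E3 | μ.map (fun x : E3 => x - u) ∈ G}ᶜ from hy), one_mul]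
    · rw [Set.indicator_of_notMem hμG]
      refine (lintegral_congr fun y => ?_).trans lintegral_zero
      simp only [hg, Set.indicator_of_notMem hμG, zero_mul]
  -- right side: bounded by the full moment at deleted roots
  have hR : ∫⁻ μ, ∫⁻ y, g (μ.map fun x : E3 => x - y) (-y) ∂μ ∂P ≤ ∫⁻ μ in Gᶜ, (∫⁻ y, f y ∂μ) ∂P := by
    rw [← lintegral_indicator hG.compl]
    refine lintegral_mono_ae (hcore.mono fun μ hμ => ?_)
    have hμ' := hμ
    obtain ⟨S, h0S, hsep, rfl⟩ := hμ
    have hpt : ∀ y ∈ S, g (((Measure.count : Measure E3).restrict S).map fun x : E3 => x - y) (-y) ≤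
        Gᶜ.indicator (fun _ => (1 : ℝ≥0∞)) ((Measure.count : Measure E3).restrict S) * f y := by
      intro y hy
      have hy' : (Measure.count : Measure E3).restrict S {y} ≠ 0 := (count_restrict_singleton_ne_zero_iff S y).2 hy
      have hθ : IsRootedHardCore δ (((Measure.count : Measure E3).restrict S).map fun x : E3 => x - y) := hμ'.map_sub hy'
      have hmem : ((((Measure.count : Measure E3).restrict S).map fun x : E3 => x - y), -y) ∈ A ↔
          (Measure.count : Measure E3).restrict S ∈ G := by
        rw [hsec _ hθ (-y), Set.mem_setOf_eq, map_sub_map_sub_neg]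
      have hfy : f (-y) = f y := by simp only [hf, norm_neg]
      simp only [hg]
      rw [hfy]
      by_cases hμG : (Measure.count : Measure E3).restrict S ∈ G
      · rw [Set.indicator_of_notMem (show ((((Measure.count : Measure E3).restrict S).map fun x : E3 => x - y), -y) ∉ Aᶜ from
          fun h => Set.notMem_of_mem_compl h (hmem.2 hμG)), zero_mul, mul_zero]
        positivity
      · rw [Set.indicator_of_mem (show (Measure.count : Measure E3).restrict S ∈ Gᶜ from hμG), one_mul]
        calc G.indicator (fun _ => (1 : ℝ≥0∞)) (((Measure.count : Measure E3).restrict S).map fun x : E3 => x - y) *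
              (Aᶜ.indicator (fun _ => (1 : ℝ≥0∞)) ((((Measure.count : Measure E3).restrict S).map fun x : E3 => x - y), -y) * f y)
            ≤ 1 * (1 * f y) := by
              gcongr
              · exact Set.indicator_le_self' (fun _ _ => zero_le_one) _
              · exact Set.indicator_le_self' (fun _ _ => zero_le_one) _
          _ = f y := by rw [one_mul, one_mul]
    calc ∫⁻ y, g (((Measure.count : Measure E3).restrict S).map fun x : E3 => x - y) (-y) ∂((Measure.count : Measure E3).restrict S)
        ≤ ∫⁻ y, Gᶜ.indicator (fun _ => (1 : ℝ≥0∞)) ((Measure.count : Measure E3).restrict S) * f y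
            ∂((Measure.count : Measure E3).restrict S) := lintegral_mono_ae ((ae_mem_of_sep hδ hsep).mono hpt)
      _ = Gᶜ.indicator (fun μ => ∫⁻ y, f y ∂μ) ((Measure.count : Measure E3).restrict S) := by
          by_cases hμG : (Measure.count : Measure E3).restrict S ∈ Gᶜ
          · rw [Set.indicator_of_mem hμG, Set.indicator_of_mem hμG, lintegral_const_mul' _ _ ENNReal.one_ne_top, one_mul]
          · rw [Set.indicator_of_notMem hμG, Set.indicator_of_notMem hμG, lintegral_const_mul' _ _ ENNReal.zero_ne_top, zero_mul]
  calc ∫⁻ μ in G, (∫⁻ y in {u : E3 | μ.map (fun x : E3 => x - u) ∈ G}ᶜ, f y ∂μ) ∂P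
      = ∫⁻ μ, ∫⁻ y, g μ y ∂μ ∂P := hL.symm
    _ = ∫⁻ μ, ∫⁻ y, g (μ.map fun x : E3 => x - y) (-y) ∂μ ∂P := key
    _ ≤ ∫⁻ μ in Gᶜ, (∫⁻ y, f y ∂μ) ∂P := hR

end DeletedAtoms

end Summit.AtomisticToContinuum.Crystallization.Theorems.FrustratedLawDichotomyThinning

end
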